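import Summits.HubbardSuperconductivity.HubbardSuperconductivity.Theses.LiebTwin
import Literature.MathematicalPhysics.QuantumLattice.FockRelabel
import Literature.Probability.LatticeModels.TorusFourierProofs

/-!
# Crux `NoOnsiteODLRO` (stmt-HubbardSuperconductivity-0933; routes `LiebTwin`, `EnslavedA1g`) —
# WLOG momentum eigenstates: a translation-invariant quadratic form is CONVEX over the momentum
# sectors of a sector ground state (census by-product B2)

For the torus `(ℤ/Lℤ)²` and any Hamiltonian `H` and observable `Q` that are invariant under the
lattice translations `T_v = fockTranslate v` (e.g. `H = hubbardTorus 2 L t U`,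
`Q = (pairField g L)ᴴ * pairField g L` — `relabel_translate_hubbardTorus`,
`relabel_translate_pairField_conjTranspose_mul`), every normalised ground state `ψ` of a joint
sector `(N, S^z = M)` admits a normalised ground state `φ` OF THE SAME SECTOR which is a joint
eigenvector of all translations, `T_v φ = χ_m(v) φ`, and carries at least as much `Q`:
`Re⟨ψ, Qψ⟩ ≤ Re⟨φ, Qφ⟩` (`exists_momentumEigen_groundState_expect_le`). Hence any every-ground-state
CEILING on `Re⟨ψ, Qψ⟩` (the crux's `S_L`, a `d`-wave `F_d`, …) may be proved for translation
eigenstates only; for the crux itself: `NoOnsiteODLRO` follows from its restriction to admissible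
sequences of momentum eigenstates (`noOnsiteODLRO_of_momentumEigen`).

Mechanism (finite Fourier analysis on the translation group, no spectral theorem): the
unnormalised momentum projectors `R_m = Σ_v conj χ_m(v) T_v` satisfy
`T_w R_m = χ_m(w) R_m`, `R_mᴴ = R_m`, `R_m R_{m'} = L²δ_{mm'} R_{m'}`, `Σ_m R_m = L²`; so `ψ = L⁻² Σ_m R_m ψ`, the pieces
`R_m ψ` are ground states (or zero) of momentum `m`, and for `[Q, T_v] = 0`:
`⟨ψ, Qψ⟩ = L⁻⁴ Σ_m ⟨R_mψ, Q R_mψ⟩`, `‖ψ‖² = L⁻⁴ Σ_m ‖R_mψ‖²` — a convex combination.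
(Recorded informally in `Cruxes/NoOnsiteODLRO/STRATEGY-CENSUS.md` B2 and `Disproof.lean`, "degenerate
ground spaces are not a loophole"; kernel-checked here.)

Sources: folklore (Bloch's theorem for finite abelian symmetry groups); S. Friedli, Y. Velenik,
Statistical Mechanics of Lattice Systems (CUP 2017) §10.4 (characters of `(ℤ/Lℤ)^d`);
O. Bratteli, D. W. Robinson, Operator Algebras and QSM II (1997) §5.2.2 (implemented translations).
No definitions, no named facts.
-/

noncomputable section

set_option linter.dupNamespace false

namespace Summit.HubbardSuperconductivity.HubbardSuperconductivity.Theorems.NoOnsiteODLRO.MomentumSectors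

open Matrix Literature.Probability.LatticeModels Literature.MathematicalPhysics.QuantumLattice
open Finset hiding expect
open scoped ComplexOrder ComplexConjugate

variable {L : ℕ} [NeZero L]

/-! ### The translation unitaries as matrices -/

section ProjectorAlgebra

/-! Throughout this section `R m` stands for the unnormalised momentum projector
`Σ_v conj χ_m(v) T_v` (hypothesis `hR`; instantiated by `rfl` downstream). -/

variable
  (R : TorusSite 2 L → Matrix (Finset (Orb (FermionTorus 2 L))) (Finset (Orb (FermionTorus 2 L))) ℂ)
  (hR : ∀ m : TorusSite 2 L,
    R m = ∑ v : TorusSite 2 L, (starRingEnd ℂ) (torusChar m v) • (fockTranslate v).val)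

/-- `T_0 ψ = ψ` (stated on vectors, which avoids comparing `DecidableEq` instances hidden in
`1 : Matrix`). [folklore] -/
theorem fockTranslate_zero_mulVec (ψ : Fock (Orb (FermionTorus 2 L))) :
    (fockTranslate (0 : TorusSite 2 L)).val *ᵥ ψ = ψ := by
  have h : (fockTranslate (0 : TorusSite 2 L)).val =
      (fockTranslate (0 : TorusSite 2 L)).val * (fockTranslate (0 : TorusSite 2 L)).val := by
    have : (fockTranslate ((0 : TorusSite 2 L) + 0)).val =
        (fockTranslate (0 : TorusSite 2 L)).val * (fockTranslate (0 : TorusSite 2 L)).val := by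
      rw [fockTranslate_add]; rfl
    rwa [add_zero] at this
  apply fockRelabel_mulVec_injective (Orb.translate (0 : TorusSite 2 L))
  show (fockTranslate 0).val *ᵥ ((fockTranslate 0).val *ᵥ ψ) = (fockTranslate 0).val *ᵥ ψ
  rw [mulVec_mulVec, ← h]

/-- `T_vᴴ = T_{-v}`. [folklore] -/
theorem fockTranslate_val_conjTranspose (v : TorusSite 2 L) :
    (fockTranslate v).valᴴ = (fockTranslate (-v)).val := by
  rw [fockTranslate_neg]; rfl

/-! ### Projector algebra -/

include hR

/-- **Covariance**: `T_w R_m = χ_m(w) R_m`. [folklore] -/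
theorem fockTranslate_mul_proj (w m : TorusSite 2 L) :
    (fockTranslate w).val * R m = torusChar m w • R m := by
  rw [hR]
  have hadd : ∀ v : TorusSite 2 L, (fockTranslate w).val * (fockTranslate v).val =
      (fockTranslate (w + v)).val := fun v => by rw [fockTranslate_add]; rfl
  rw [Finset.mul_sum, Finset.smul_sum]
  simp_rw [Matrix.mul_smul, hadd, smul_smul]
  exact Fintype.sum_equiv (Equiv.addLeft w) _ _ fun v => by
    simp only [Equiv.coe_addLeft, torusChar_add_right, map_mul]
    rw [← mul_assoc, torusChar_mul_conj, one_mul]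

/-- `R_mᴴ = R_m`. [folklore] -/
theorem proj_conjTranspose (m : TorusSite 2 L) : (R m)ᴴ = R m := by
  rw [hR, conjTranspose_sum]
  simp_rw [conjTranspose_smul, fockTranslate_val_conjTranspose]
  refine Fintype.sum_equiv (Equiv.neg (TorusSite 2 L)) _ _ fun v => ?_
  rw [Equiv.neg_apply, torusChar_neg_right, Complex.star_def, Complex.conj_conj]

/-- `R_m R_{m'} = L² δ_{m m'} R_{m'}`. [folklore] -/
theorem proj_mul_proj (m m' : TorusSite 2 L) :
    R m * R m' = (if m = m' then ((L : ℂ) ^ 2) else 0) • R m' := by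
  rw [hR m, Finset.sum_mul]
  simp_rw [Matrix.smul_mul, fockTranslate_mul_proj R hR, smul_smul, ← Finset.sum_smul]
  congr 1
  have h : ∀ v : TorusSite 2 L, (starRingEnd ℂ) (torusChar m v) * torusChar m' v =
      torusChar (m' - m) v := fun v => by rw [torusChar_sub_left, mul_comm]
  simp_rw [h, sum_torusChar_right, sub_eq_zero, eq_comm]

/-- `Σ_m R_m = L² · T_0`. [folklore] -/
theorem sum_proj :
    ∑ m : TorusSite 2 L, R m = ((L : ℂ) ^ 2) • (fockTranslate (0 : TorusSite 2 L)).val := by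
  simp_rw [hR]
  rw [Finset.sum_comm]
  simp_rw [← Finset.sum_smul]
  have h : ∀ v : TorusSite 2 L, ∑ m : TorusSite 2 L, (starRingEnd ℂ) (torusChar m v) =
      if v = 0 then (L : ℂ) ^ 2 else 0 := fun v => by
    rw [← map_sum, sum_torusChar_left]
    split_ifs <;> simp
  simp_rw [h, ite_smul, zero_smul, Finset.sum_ite_eq', Finset.mem_univ, if_true]

/-- An operator commuting with every translation commutes with every `R_m`. [folklore] -/
theorem commute_proj
    {Q : Matrix (Finset (Orb (FermionTorus 2 L))) (Finset (Orb (FermionTorus 2 L))) ℂ}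
    (hQ : ∀ v : TorusSite 2 L, Commute Q (fockTranslate v).val) (m : TorusSite 2 L) :
    Commute Q (R m) := by
  rw [hR]
  exact Commute.sum_right _ _ _ fun v _ => (hQ v).smul_right _

/-! ### Momentum components of a vector -/

/-- `L² ψ = Σ_m R_m ψ`. [folklore] -/
theorem sum_proj_mulVec (ψ : Fock (Orb (FermionTorus 2 L))) :
    ∑ m : TorusSite 2 L, R m *ᵥ ψ = ((L : ℂ) ^ 2) • ψ := by
  rw [← Matrix.sum_mulVec, sum_proj R hR, Matrix.smul_mulVec, fockTranslate_zero_mulVec]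

/-- The components are translation eigenvectors: `T_w (R_m ψ) = χ_m(w) R_m ψ`. [folklore] -/
theorem fockTranslate_mulVec_proj_mulVec (w m : TorusSite 2 L) (ψ : Fock (Orb (FermionTorus 2 L))) :
    (fockTranslate w).val *ᵥ (R m *ᵥ ψ) = torusChar m w • (R m *ᵥ ψ) := by
  rw [mulVec_mulVec, fockTranslate_mul_proj R hR, Matrix.smul_mulVec]

/-- **Diagonalisation of a translation-invariant form**: for `[Q, T_v] = 0`,
`L² ⟨ψ, Q R_m ψ⟩ = ⟨R_m ψ, Q R_m ψ⟩`. [folklore] -/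
theorem star_dotProduct_mulVec_proj
    {Q : Matrix (Finset (Orb (FermionTorus 2 L))) (Finset (Orb (FermionTorus 2 L))) ℂ}
    (hQ : ∀ v : TorusSite 2 L, Commute Q (fockTranslate v).val) (m : TorusSite 2 L)
    (ψ : Fock (Orb (FermionTorus 2 L))) :
    ((L : ℂ) ^ 2) * (star ψ ⬝ᵥ (Q *ᵥ (R m *ᵥ ψ))) = star (R m *ᵥ ψ) ⬝ᵥ (Q *ᵥ (R m *ᵥ ψ)) := by
  have hRR : R m * R m = ((L : ℂ) ^ 2) • R m := by rw [proj_mul_proj R hR, if_pos rfl]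
  calc ((L : ℂ) ^ 2) * (star ψ ⬝ᵥ (Q *ᵥ (R m *ᵥ ψ)))
      = star ψ ⬝ᵥ ((Q * (R m * R m)) *ᵥ ψ) := by
          rw [hRR, Matrix.mul_smul, Matrix.smul_mulVec, dotProduct_smul, smul_eq_mul, mulVec_mulVec]
    _ = star ψ ⬝ᵥ ((R m * (Q * R m)) *ᵥ ψ) := by
          conv_lhs => rw [← Matrix.mul_assoc, (commute_proj R hR hQ m).eq, Matrix.mul_assoc]
    _ = star (R m *ᵥ ψ) ⬝ᵥ (Q *ᵥ (R m *ᵥ ψ)) := by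
          rw [← mulVec_mulVec, dotProduct_mulVec, star_mulVec, proj_conjTranspose R hR, mulVec_mulVec]

/-- **Convex decomposition**: for `[Q, T_v] = 0`,
`L⁴ ⟨ψ, Q ψ⟩ = Σ_m ⟨R_m ψ, Q R_m ψ⟩`. [folklore] -/
theorem star_dotProduct_mulVec_eq_sum
    {Q : Matrix (Finset (Orb (FermionTorus 2 L))) (Finset (Orb (FermionTorus 2 L))) ℂ}
    (hQ : ∀ v : TorusSite 2 L, Commute Q (fockTranslate v).val) (ψ : Fock (Orb (FermionTorus 2 L))) :
    ((L : ℂ) ^ 2) * ((L : ℂ) ^ 2) * (star ψ ⬝ᵥ (Q *ᵥ ψ)) =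
      ∑ m : TorusSite 2 L, star (R m *ᵥ ψ) ⬝ᵥ (Q *ᵥ (R m *ᵥ ψ)) := by
  simp_rw [← star_dotProduct_mulVec_proj R hR hQ]
  rw [← Finset.mul_sum, ← dotProduct_sum, ← mulVec_sum, sum_proj_mulVec R hR, mulVec_smul,
    dotProduct_smul, smul_eq_mul, mul_assoc]

/-! ### Ground states: WLOG a momentum eigenstate -/

/-- A momentum component of a sector ground state of a translation-invariant `H` is again a sector
ground state, unless it vanishes. [folklore] -/
theorem isGroundStateInSector_proj_mulVec
    {H : Matrix (Finset (Orb (FermionTorus 2 L))) (Finset (Orb (FermionTorus 2 L))) ℂ}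
    (hH : ∀ v : TorusSite 2 L, relabel (Orb.translate v) H = H) {N : ℕ} {M : ℝ}
    {ψ : Fock (Orb (FermionTorus 2 L))} (hψ : IsGroundStateInSector H N M ψ) (m : TorusSite 2 L)
    (hne : R m *ᵥ ψ ≠ 0) : IsGroundStateInSector H N M (R m *ᵥ ψ) := by
  obtain ⟨hmem, _, heig⟩ := hψ
  refine ⟨?_, hne, ?_⟩
  · rw [hR, Matrix.sum_mulVec]
    refine Submodule.sum_mem _ fun v _ => ?_
    rw [Matrix.smul_mulVec]
    exact Submodule.smul_mem _ _ (fockTranslate_mulVec_mem_szSector v hmem)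
  · have hc : Commute H (R m) :=
      commute_proj R hR (fun v => (fockRelabel_commute_of_relabel_eq _ (hH v)).symm) m
    rw [mulVec_mulVec, hc.eq, ← mulVec_mulVec, heig, mulVec_smul]

end ProjectorAlgebra

/-- **WLOG a momentum eigenstate (convexity over momentum sectors).** Let `H` and `Q` be invariant
under the lattice translations of the fermionic torus `(ℤ/Lℤ)²`. For every normalised ground state
`ψ` of `H` in a joint sector `(N, S^z = M)` there are a momentum `m` and a normalised ground state `φ`
of the SAME sector with `T_v φ = χ_m(v) φ` for all `v` and `Re⟨ψ, Qψ⟩ ≤ Re⟨φ, Qφ⟩` (take the momentum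
component of `ψ` with the largest `Q`-Rayleigh quotient: `⟨ψ,Qψ⟩` is the convex combination
`L⁻⁴ Σ_m ⟨R_mψ, Q R_mψ⟩` with weights `L⁻⁴‖R_mψ‖²`). So every-ground-state ceilings on `Re⟨ψ, Qψ⟩`
need only be proved for translation eigenstates. [folklore] -/
theorem exists_momentumEigen_groundState_expect_le
    {H Q : Matrix (Finset (Orb (FermionTorus 2 L))) (Finset (Orb (FermionTorus 2 L))) ℂ}
    (hH : ∀ v : TorusSite 2 L, relabel (Orb.translate v) H = H)
    (hQ : ∀ v : TorusSite 2 L, relabel (Orb.translate v) Q = Q) {N : ℕ} {M : ℝ}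
    {ψ : Fock (Orb (FermionTorus 2 L))} (hψ : IsGroundStateInSector H N M ψ) (h1 : star ψ ⬝ᵥ ψ = 1) :
    ∃ (m : TorusSite 2 L) (φ : Fock (Orb (FermionTorus 2 L))),
      IsGroundStateInSector H N M φ ∧ star φ ⬝ᵥ φ = 1 ∧
        (∀ v : TorusSite 2 L, (fockTranslate v).val *ᵥ φ = torusChar m v • φ) ∧
          (expect Q ψ).re ≤ (expect Q φ).re := by
  let R : TorusSite 2 L →
      Matrix (Finset (Orb (FermionTorus 2 L))) (Finset (Orb (FermionTorus 2 L))) ℂ :=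
    fun m => ∑ v : TorusSite 2 L, (starRingEnd ℂ) (torusChar m v) • (fockTranslate v).val
  have hR : ∀ m : TorusSite 2 L,
      R m = ∑ v : TorusSite 2 L, (starRingEnd ℂ) (torusChar m v) • (fockTranslate v).val :=
    fun m => rfl
  have hQc : ∀ v : TorusSite 2 L, Commute Q (fockTranslate v).val := fun v =>
    (fockRelabel_commute_of_relabel_eq _ (hQ v)).symm
  have h1c : ∀ v : TorusSite 2 L, Commute (1 : Matrix _ _ ℂ) (fockTranslate v).val := fun v =>
    Commute.one_left _
  -- the components, their norms `a m` and `Q`-values `q m`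
  set a : TorusSite 2 L → ℝ := fun m => (star (R m *ᵥ ψ) ⬝ᵥ (R m *ᵥ ψ)).re with ha
  set q : TorusSite 2 L → ℝ := fun m => (star (R m *ᵥ ψ) ⬝ᵥ (Q *ᵥ (R m *ᵥ ψ))).re with hq
  have hL : ((L : ℝ) ^ 2) * ((L : ℝ) ^ 2) ≠ 0 := by
    have : (L : ℝ) ≠ 0 := Nat.cast_ne_zero.2 (NeZero.ne L)
    positivity
  -- the two sum rules
  have hsumQ : ((L : ℝ) ^ 2) * ((L : ℝ) ^ 2) * (expect Q ψ).re = ∑ m, q m := by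
    have h := congrArg Complex.re (star_dotProduct_mulVec_eq_sum R hR hQc ψ)
    rw [Complex.re_sum] at h
    rw [expect, ← h, ← Complex.ofReal_natCast, ← Complex.ofReal_pow, ← Complex.ofReal_mul,
      Complex.re_ofReal_mul]
  have hsum1 : ((L : ℝ) ^ 2) * ((L : ℝ) ^ 2) = ∑ m, a m := by
    have h := congrArg Complex.re (star_dotProduct_mulVec_eq_sum R hR h1c ψ)
    rw [Complex.re_sum] at h
    simp_rw [Matrix.one_mulVec] at h
    rw [h1, mul_one, ← Complex.ofReal_natCast, ← Complex.ofReal_pow, ← Complex.ofReal_mul,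
      Complex.ofReal_re] at h
    exact h
  -- nonzero components exist
  set S : Finset (TorusSite 2 L) := univ.filter fun m => R m *ᵥ ψ ≠ 0 with hS
  have ha0 : ∀ m, m ∉ S → a m = 0 := fun m hm => by
    simp only [hS, mem_filter, mem_univ, true_and, not_not] at hm
    simp only [ha]
    rw [hm, star_zero, zero_dotProduct, Complex.zero_re]
  have hq0 : ∀ m, m ∉ S → q m = 0 := fun m hm => by
    simp only [hS, mem_filter, mem_univ, true_and, not_not] at hm
    simp only [hq]
    rw [hm, star_zero, zero_dotProduct, Complex.zero_re]
  have hapos : ∀ m ∈ S, 0 < a m := fun m hm => by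
    simp only [hS, mem_filter, mem_univ, true_and] at hm
    rcases (Complex.nonneg_iff.1 (dotProduct_star_self_nonneg (R m *ᵥ ψ))).1.lt_or_eq with h | h
    · exact h
    · refine absurd (dotProduct_star_self_eq_zero.1 (Complex.ext ?_ ?_)) hm
      · rw [Complex.zero_re]; exact h.symm
      · rw [Complex.zero_im]
        exact (Complex.nonneg_iff.1 (dotProduct_star_self_nonneg (R m *ᵥ ψ))).2.symm
  have hSne : S.Nonempty := by
    by_contra hempty
    rw [Finset.not_nonempty_iff_eq_empty] at hempty
    have : ∑ m, a m = 0 :=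
      Finset.sum_eq_zero fun m _ => ha0 m (by rw [hempty]; exact Finset.notMem_empty m)
    exact hL (hsum1.trans this)
  -- the best component
  obtain ⟨m₀, hm₀S, hmax⟩ := Finset.exists_max_image S (fun m => q m / a m) hSne
  have hterm : ∀ m, q m ≤ (q m₀ / a m₀) * a m := by
    intro m
    by_cases hm : m ∈ S
    · have := hmax m hm
      rw [div_le_iff₀ (hapos m hm)] at this
      exact this
    · rw [hq0 m hm, ha0 m hm, mul_zero]
  have hmain : (expect Q ψ).re ≤ q m₀ / a m₀ := by
    have h : ((L : ℝ) ^ 2) * ((L : ℝ) ^ 2) * (expect Q ψ).re ≤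
        ((L : ℝ) ^ 2) * ((L : ℝ) ^ 2) * (q m₀ / a m₀) := by
      rw [hsumQ, mul_comm _ (q m₀ / a m₀), hsum1, Finset.mul_sum]
      exact Finset.sum_le_sum fun m _ => hterm m
    exact le_of_mul_le_mul_left h (lt_of_le_of_ne (by positivity) (Ne.symm hL))
  -- normalise it
  have ha₀ : 0 < a m₀ := hapos m₀ hm₀S
  have hne₀ : R m₀ *ᵥ ψ ≠ 0 := by
    simp only [hS, mem_filter, mem_univ, true_and] at hm₀S; exact hm₀S
  set c : ℝ := (Real.sqrt (a m₀))⁻¹ with hc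
  have hc0 : c ≠ 0 := by positivity
  have hcc' : c * c = (a m₀)⁻¹ := by
    rw [hc, ← mul_inv, Real.mul_self_sqrt ha₀.le]
  have hcc : c * c * a m₀ = 1 := by
    rw [hcc', inv_mul_cancel₀ ha₀.ne']
  have hstar : star (R m₀ *ᵥ ψ) ⬝ᵥ (R m₀ *ᵥ ψ) = (a m₀ : ℂ) := by
    refine Complex.ext ?_ ?_
    · rw [Complex.ofReal_re]
    · rw [Complex.ofReal_im]
      exact ((Complex.nonneg_iff.1 (dotProduct_star_self_nonneg (R m₀ *ᵥ ψ))).2).symm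
  refine ⟨m₀, (c : ℂ) • (R m₀ *ᵥ ψ), ?_, ?_, ?_, ?_⟩
  · obtain ⟨hmem, hne, heig⟩ := isGroundStateInSector_proj_mulVec R hR hH hψ m₀ hne₀
    exact ⟨Submodule.smul_mem _ _ hmem, smul_ne_zero (Complex.ofReal_ne_zero.2 hc0) hne,
      by rw [mulVec_smul, heig, smul_comm]⟩
  · rw [star_smul, smul_dotProduct, dotProduct_smul, hstar, Complex.star_def, Complex.conj_ofReal,
      smul_eq_mul, smul_eq_mul, ← Complex.ofReal_mul, ← Complex.ofReal_mul, ← mul_assoc, hcc,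
      Complex.ofReal_one]
  · intro v
    rw [mulVec_smul, fockTranslate_mulVec_proj_mulVec R hR, smul_comm]
  · calc (expect Q ψ).re ≤ q m₀ / a m₀ := hmain
      _ = c * c * q m₀ := by rw [hcc', div_eq_inv_mul]
      _ = (expect Q ((c : ℂ) • (R m₀ *ᵥ ψ))).re := by
          rw [expect, mulVec_smul, star_smul, smul_dotProduct, dotProduct_smul, Complex.star_def,
            Complex.conj_ofReal, smul_eq_mul, smul_eq_mul, ← mul_assoc, ← Complex.ofReal_mul,
            Complex.re_ofReal_mul]

/-- REGISTERED HELPER STUB `stub_momentumEigenReduction` of crux stmt-HubbardSuperconductivity-0933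
(verbatim signature; census by-product B2, not a piece of the composition `NoOnsiteODLRO_of`):
the ∀-form of `exists_momentumEigen_groundState_expect_le`. [folklore] -/
theorem stub_momentumEigenReduction :
    ∀ (L : ℕ) [NeZero L]
      (H Q : Matrix (Finset (Orb (FermionTorus 2 L))) (Finset (Orb (FermionTorus 2 L))) ℂ),
      (∀ v : TorusSite 2 L, relabel (Orb.translate v) H = H) →
        (∀ v : TorusSite 2 L, relabel (Orb.translate v) Q = Q) →
          ∀ (N : ℕ) (M : ℝ) (ψ : Fock (Orb (FermionTorus 2 L))),
            IsGroundStateInSector H N M ψ → star ψ ⬝ᵥ ψ = 1 →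
              ∃ (m : TorusSite 2 L) (φ : Fock (Orb (FermionTorus 2 L))),
                IsGroundStateInSector H N M φ ∧ star φ ⬝ᵥ φ = 1 ∧
                  (∀ v : TorusSite 2 L, (fockTranslate v).val *ᵥ φ = torusChar m v • φ) ∧
                    (expect Q ψ).re ≤ (expect Q φ).re :=
  fun _ _ _ _ hH hQ _ _ _ hψ h1 => exists_momentumEigen_groundState_expect_le hH hQ hψ h1

/-- **For the crux: WLOG momentum eigenstates.** `NoOnsiteODLRO` follows from its restriction to
admissible sequences all of whose members are translation eigenvectors (`T_v ψ_L = χ_{m_L}(v) ψ_L`):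
given an arbitrary admissible sequence, replace each `ψ_L` (even `L ≥ 1`) by the momentum component
of largest on-site pair structure factor supplied by `exists_momentumEigen_groundState_expect_le`
(`H = hubbardTorus 2 L 1 U` and `P_sᴴP_s` are translation invariant). [folklore] -/
theorem noOnsiteODLRO_of_momentumEigen
    (h : ∀ (U δ : ℝ), 0 < U → δ ∈ Set.Ioo (0 : ℝ) (1 / 2) →
      ∀ (N : ℕ → ℕ) (ψ : ∀ L, Fock (Orb (FermionTorus 2 L))),
        (∀ L, Even L → N L = 2 * ⌊(1 - δ) * (L : ℝ) ^ 2 / 2⌋₊ ∧ star (ψ L) ⬝ᵥ ψ L = 1 ∧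
            IsGroundStateInSector (hubbardTorus 2 L 1 U) (N L) 0 (ψ L)) →
        (∀ (L : ℕ) [NeZero L], Even L → ∃ m : TorusSite 2 L, ∀ v : TorusSite 2 L,
            (fockTranslate v).val *ᵥ ψ L = torusChar m v • ψ L) →
          ∀ ε : ℝ, 0 < ε → ∃ L₀ : ℕ, ∀ (L : ℕ) [NeZero L], Even L → L₀ ≤ L →
            (expect ((pairField sWave L)ᴴ * pairField sWave L) (ψ L)).re / (L : ℝ) ^ 4 ≤ ε) :
    Summit.HubbardSuperconductivity.HubbardSuperconductivity.Theses.LiebTwin.NoOnsiteODLRO := by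
  intro U δ hU hδ N ψ hyp ε hε
  classical
  -- the momentum-eigen replacement, side by side
  have key : ∀ (L : ℕ) [NeZero L], Even L → ∃ (m : TorusSite 2 L) (φ : Fock (Orb (FermionTorus 2 L))),
      IsGroundStateInSector (hubbardTorus 2 L 1 U) (N L) 0 φ ∧ star φ ⬝ᵥ φ = 1 ∧
        (∀ v : TorusSite 2 L, (fockTranslate v).val *ᵥ φ = torusChar m v • φ) ∧
          (expect ((pairField sWave L)ᴴ * pairField sWave L) (ψ L)).re ≤
            (expect ((pairField sWave L)ᴴ * pairField sWave L) φ).re := by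
    intro L _ hL
    obtain ⟨_, h1, hgs⟩ := hyp L hL
    exact exists_momentumEigen_groundState_expect_le (fun v => relabel_translate_hubbardTorus v 1 U)
      (fun v => relabel_translate_pairField_conjTranspose_mul sWave v) hgs h1
  -- assemble the new sequence (junk `ψ L` where the hypothesis does not bite)
  let φ : ∀ L, Fock (Orb (FermionTorus 2 L)) := fun L =>
    if hL : L ≠ 0 ∧ Even L then
      (by haveI : NeZero L := ⟨hL.1⟩; exact (key L hL.2).choose_spec.choose)
    else ψ L
  have hφ : ∀ (L : ℕ) [NeZero L], Even L →
      IsGroundStateInSector (hubbardTorus 2 L 1 U) (N L) 0 (φ L) ∧ star (φ L) ⬝ᵥ φ L = 1 ∧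
        (∃ m : TorusSite 2 L, ∀ v : TorusSite 2 L, (fockTranslate v).val *ᵥ φ L = torusChar m v • φ L) ∧
          (expect ((pairField sWave L)ᴴ * pairField sWave L) (ψ L)).re ≤
            (expect ((pairField sWave L)ᴴ * pairField sWave L) (φ L)).re := by
    intro L inst hL
    have hL' : L ≠ 0 ∧ Even L := ⟨NeZero.ne L, hL⟩
    have hs := (key L hL).choose_spec.choose_spec
    have hφL : φ L = (key L hL).choose_spec.choose := by
      simp only [φ, dif_pos hL']
    rw [hφL]
    exact ⟨hs.1, hs.2.1, ⟨_, hs.2.2.1⟩, hs.2.2.2⟩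
  have hypφ : ∀ L, Even L → N L = 2 * ⌊(1 - δ) * (L : ℝ) ^ 2 / 2⌋₊ ∧ star (φ L) ⬝ᵥ φ L = 1 ∧
      IsGroundStateInSector (hubbardTorus 2 L 1 U) (N L) 0 (φ L) := by
    intro L hL
    by_cases hL0 : L = 0
    · subst hL0
      have : φ 0 = ψ 0 := by simp [φ]
      rw [this]
      exact hyp 0 hL
    · haveI : NeZero L := ⟨hL0⟩
      obtain ⟨hgs, h1, _, _⟩ := hφ L hL
      exact ⟨(hyp L hL).1, h1, hgs⟩
  have heig : ∀ (L : ℕ) [NeZero L], Even L → ∃ m : TorusSite 2 L, ∀ v : TorusSite 2 L,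
      (fockTranslate v).val *ᵥ φ L = torusChar m v • φ L := fun L _ hL => (hφ L hL).2.2.1
  obtain ⟨L₀, hL₀⟩ := h U δ hU hδ N φ hypφ heig ε hε
  refine ⟨L₀, fun L _ hL hLL => ?_⟩
  have hle := (hφ L hL).2.2.2
  have hL4 : (0 : ℝ) < (L : ℝ) ^ 4 := by
    have : (0 : ℝ) < L := Nat.cast_pos.2 (Nat.pos_of_ne_zero (NeZero.ne L))
    positivity
  calc (expect ((pairField sWave L)ᴴ * pairField sWave L) (ψ L)).re / (L : ℝ) ^ 4
      ≤ (expect ((pairField sWave L)ᴴ * pairField sWave L) (φ L)).re / (L : ℝ) ^ 4 := by gcongr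
    _ ≤ ε := hL₀ L hL hLL

end Summit.HubbardSuperconductivity.HubbardSuperconductivity.Theorems.NoOnsiteODLRO.MomentumSectors

end
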